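import Summits.NavierStokesRegularity.NavierStokesRegularity.Theorems.SoloRefuteHaitani2025

/-!
# SoloRefute — C133 `Haitani2025`, companion: the three charitable RE-TYPINGS of Lemma 7 (14) p.4 are false too
# (D-0090 NS-CLAIMS SWEEP; refuter ns-claims-refuter-3 g2; filed UNCHANGED by the salvage filer under conv. (b))

Bib `Haitani2025NavierStokesGitHub`; skeleton `Literature.Claims.NS.Haitani2025` (p494045 @ 552578967dbe). The typed decl
`Step3a_Lemma7GronwallAbs` (killed in `SoloRefuteHaitani2025.lean`) displays (14) as `E_k(t) ≤ E_k(0)/log(k+1)·exp(−νk²t +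
C∫₀ᵗ‖u‖/log(k+1))`. A maximally charitable reading can (R1) drop the prefactor `1/log(k+1)` as a misprint, (R2) read `E_k(0)`
as the TOTAL initial energy `‖u₀‖²_{L²} = M(0)²` (the `E₀` of (19), (23) p.5), or (R3) both. Each theorem below negates the
INLINE statement that differs from `Step3a_Lemma7GronwallAbs` ONLY in that displayed conclusion (hypotheses verbatim), on the
transfer family `haitaniE` / `haitaniM` of the main file (`haitani_family_spec`):

| re-typing | theorem | instance |
|---|---|---|
| R1: no prefactor | `not_Step3a_retype_noPrefactor` | `(c,a) = (1,1)`, `k = 1`, `t = 1`: `0 < E₁(1) ≤ E₁(0)·exp(…) = 0` |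
| R2: `E_k(0) ↦ M(0)²`, prefactor kept | `not_Step3a_retype_totalEnergy` | `(1,1)`, `k = 2`, `t = 0`: `1 ≤ 1/log 3` |
| R3: both | `not_Step3a_retype_noPrefactor_totalEnergy` | `(30, 10⁻⁴)` (`C = 60 log 2`), `k = 1`, `t = 1` |

Why R3 dies: the coupling term of (8) is LINEAR in the amplitude of `(E_k)` while the Grönwall factor `exp(C∫‖u‖/log(k+1))`
of (14) is SUBLINEAR; at amplitude `a = 10⁻⁴` with `C/ν = 60 log 2` the factor is `< e^{0.19}` and cannot pay for the
transfer `E₁(1) = (10a(e^{−1} − e^{−4}))² > 4a² > a² = M(0)²` (by the rescaling `t ↦ νt` only `C/ν` matters).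
Axioms: propext, Classical.choice, Quot.sound.

WHAT THIS IS NOT: not a claim about NS regularity or blow-up; not a claim about any author beyond the typed locator.
-/

set_option linter.dupNamespace false

noncomputable section

namespace Summit.NavierStokesRegularity.NavierStokesRegularity.Theorems.Haitani2025

open Set MeasureTheory
open Literature.Claims.NS.Haitani2025

/-- **RETYPE R1 of Step 3a (the prefactor `1/log(k+1)` of (14) read as a misprint and DROPPED; everything else verbatim
`Step3a_Lemma7GronwallAbs`): still false** — family `(1,1)`, `k = 1`, `t = 1`: `0 < E₁(1) ≤ E₁(0)·exp(…) = 0`.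
[cite: Haitani2025NavierStokesGitHub, Lemma 7 (14) p.4; Lemma 6 (8) p.3] -/
theorem not_Step3a_retype_noPrefactor :
    ¬ (∀ (ν C C₀ : ℝ), 0 < ν → 0 < C → 0 ≤ C₀ →
      ∀ (E : ℕ → ℝ → ℝ) (M : ℝ → ℝ), Continuous M → (∀ t, 0 ≤ t → 0 ≤ M t) →
        (∀ k t, 0 ≤ t → 0 ≤ E k t) →
        (∀ k t, 0 ≤ t → DifferentiableWithinAt ℝ (E k) (Ici 0) t) →
        (∀ k : ℕ, 1 ≤ k → ∀ t : ℝ, 0 ≤ t →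
            derivWithin (E k) (Ici 0) t ≤
              -2 * ν * (k : ℝ) ^ 2 * E k t + C / logW k * Real.sqrt (E k t) * Real.sqrt (E (k + 1) t)) →
        (∀ t : ℝ, 0 ≤ t → (Summable fun k => E k t) ∧ ∑' k, E k t = M t ^ 2 ∧ M t ^ 2 ≤ C₀) →
          ∀ k : ℕ, 1 ≤ k → ∀ t : ℝ, 0 ≤ t →
            E k t ≤ E k 0 * Real.exp (-ν * (k : ℝ) ^ 2 * t + C * ∫ s in (0 : ℝ)..t, M s / logW k)) := by
  intro h
  obtain ⟨h1, h2, h3, h4, h5, h6⟩ := haitani_family_spec one_pos one_pos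
  have hC : (0 : ℝ) < 2 * 1 * Real.log 2 := by
    have := Real.log_pos (by norm_num : (1 : ℝ) < 2)
    positivity
  have hmain := h 1 (2 * 1 * Real.log 2) ((1 * 1) ^ 2 + 1 ^ 2) one_pos hC (by norm_num) (haitaniE 1 1) (haitaniM 1 1)
    h1 h2 h3 h4 h5 h6 1 le_rfl 1 zero_le_one
  rw [haitaniE_one_zero, zero_mul] at hmain
  exact absurd hmain (not_le.mpr (haitaniE_one_pos one_pos one_pos one_pos))

/-- **RETYPE R2 of Step 3a (`E_k(0)` in (14) read as the TOTAL initial energy `‖u₀‖²_{L²} = M(0)²`, as (19) and (23) p.5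
later use `E₀`; prefactor kept; everything else verbatim): still false** — family `(1,1)`, `k = 2`, `t = 0`: `M(0)² = E₂(0) = 1`
and (14) reads `1 ≤ 1/log 3`. [cite: Haitani2025NavierStokesGitHub, Lemma 7 (14) p.4; (19), (23) p.5] -/
theorem not_Step3a_retype_totalEnergy :
    ¬ (∀ (ν C C₀ : ℝ), 0 < ν → 0 < C → 0 ≤ C₀ →
      ∀ (E : ℕ → ℝ → ℝ) (M : ℝ → ℝ), Continuous M → (∀ t, 0 ≤ t → 0 ≤ M t) →
        (∀ k t, 0 ≤ t → 0 ≤ E k t) →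
        (∀ k t, 0 ≤ t → DifferentiableWithinAt ℝ (E k) (Ici 0) t) →
        (∀ k : ℕ, 1 ≤ k → ∀ t : ℝ, 0 ≤ t →
            derivWithin (E k) (Ici 0) t ≤
              -2 * ν * (k : ℝ) ^ 2 * E k t + C / logW k * Real.sqrt (E k t) * Real.sqrt (E (k + 1) t)) →
        (∀ t : ℝ, 0 ≤ t → (Summable fun k => E k t) ∧ ∑' k, E k t = M t ^ 2 ∧ M t ^ 2 ≤ C₀) →
          ∀ k : ℕ, 1 ≤ k → ∀ t : ℝ, 0 ≤ t →
            E k t ≤ M 0 ^ 2 / logW k * Real.exp (-ν * (k : ℝ) ^ 2 * t + C * ∫ s in (0 : ℝ)..t, M s / logW k)) := by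
  intro h
  obtain ⟨h1, h2, h3, h4, h5, h6⟩ := haitani_family_spec one_pos one_pos
  have hC : (0 : ℝ) < 2 * 1 * Real.log 2 := by
    have := Real.log_pos (by norm_num : (1 : ℝ) < 2)
    positivity
  have hmain := h 1 (2 * 1 * Real.log 2) ((1 * 1) ^ 2 + 1 ^ 2) one_pos hC (by norm_num) (haitaniE 1 1) (haitaniM 1 1)
    h1 h2 h3 h4 h5 h6 2 (by norm_num) 0 le_rfl
  rw [intervalIntegral.integral_same, logW_two, haitaniE_two, haitaniM_zero_sq 1 zero_le_one] at hmain
  norm_num at hmain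
  have hl3 : 1 < Real.log 3 := by
    rw [Real.lt_log_iff_exp_lt (by norm_num : (0 : ℝ) < 3)]
    exact lt_trans Real.exp_one_lt_d9 (by norm_num)
  have hl : (Real.log 3)⁻¹ < 1 := inv_lt_one_of_one_lt₀ hl3
  linarith

/-- **RETYPE R3 of Step 3a (BOTH charities: no prefactor AND `E_k(0)` read as `‖u₀‖² = M(0)²`; everything else verbatim):
still false** — family `(c,a) = (30, 10⁻⁴)` (`ν = 1`, `C = 60 log 2`), `k = 1`, `t = 1`: `M ≤ 31a` on `[0, ∞)` gives
`C∫₀¹M/log 2 = 60∫₀¹M ≤ 1860a < 1`, so the right side is `< M(0)² = a²`, while `E₁(1) = (10a(e^{−1} − e^{−4}))² > (2a)²`.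
[cite: Haitani2025NavierStokesGitHub, Lemma 7 (14) p.4; Lemma 6 (8) p.3] -/
theorem not_Step3a_retype_noPrefactor_totalEnergy :
    ¬ (∀ (ν C C₀ : ℝ), 0 < ν → 0 < C → 0 ≤ C₀ →
      ∀ (E : ℕ → ℝ → ℝ) (M : ℝ → ℝ), Continuous M → (∀ t, 0 ≤ t → 0 ≤ M t) →
        (∀ k t, 0 ≤ t → 0 ≤ E k t) →
        (∀ k t, 0 ≤ t → DifferentiableWithinAt ℝ (E k) (Ici 0) t) →
        (∀ k : ℕ, 1 ≤ k → ∀ t : ℝ, 0 ≤ t →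
            derivWithin (E k) (Ici 0) t ≤
              -2 * ν * (k : ℝ) ^ 2 * E k t + C / logW k * Real.sqrt (E k t) * Real.sqrt (E (k + 1) t)) →
        (∀ t : ℝ, 0 ≤ t → (Summable fun k => E k t) ∧ ∑' k, E k t = M t ^ 2 ∧ M t ^ 2 ≤ C₀) →
          ∀ k : ℕ, 1 ≤ k → ∀ t : ℝ, 0 ≤ t →
            E k t ≤ M 0 ^ 2 * Real.exp (-ν * (k : ℝ) ^ 2 * t + C * ∫ s in (0 : ℝ)..t, M s / logW k)) := by
  intro h
  set a : ℝ := 1 / 10000 with ha_def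
  have ha : (0 : ℝ) < a := by norm_num [ha_def]
  have hc : (0 : ℝ) < 30 := by norm_num
  obtain ⟨h1, h2, h3, h4, h5, h6⟩ := haitani_family_spec hc ha
  have hlog : 0 < Real.log 2 := Real.log_pos (by norm_num)
  have hC : (0 : ℝ) < 2 * 30 * Real.log 2 := by positivity
  have hmain := h 1 (2 * 30 * Real.log 2) ((30 * a) ^ 2 + a ^ 2) one_pos hC (by positivity) (haitaniE 30 a) (haitaniM 30 a)
    h1 h2 h3 h4 h5 h6 1 le_rfl 1 zero_le_one
  -- M on [0,1] is at most 31 a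
  have hMle : ∀ s : ℝ, 0 ≤ s → haitaniM 30 a s ≤ 31 * a := by
    intro s hs
    show Real.sqrt (haitaniG 30 a s ^ 2 + a ^ 2 * Real.exp (-8 * s)) ≤ 31 * a
    rw [Real.sqrt_le_left (by positivity)]
    have hg0 := haitaniG_nonneg hc.le ha.le hs
    have hg1 := haitaniG_le hc.le ha.le hs
    have hA : haitaniG 30 a s ^ 2 ≤ (30 * a) ^ 2 := pow_le_pow_left₀ hg0 hg1 2
    have he : Real.exp (-8 * s) ≤ 1 := Real.exp_le_one_iff.mpr (by linarith)
    have hB : a ^ 2 * Real.exp (-8 * s) ≤ a ^ 2 := by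
      have := mul_le_mul_of_nonneg_left he (sq_nonneg a)
      linarith
    nlinarith
  have hint : ∫ s in (0 : ℝ)..1, haitaniM 30 a s / logW 1 ≤ 31 * a / Real.log 2 := by
    rw [intervalIntegral.integral_div, logW_one]
    refine div_le_div_of_nonneg_right ?_ hlog.le
    have hb := intervalIntegral.norm_integral_le_of_norm_le_const (a := (0 : ℝ)) (b := 1)
      (f := haitaniM 30 a) (C := 31 * a) (by
        intro s hs
        rw [uIoc_of_le zero_le_one] at hs
        rw [Real.norm_of_nonneg (h2 s hs.1.le)]
        exact hMle s hs.1.le)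
    rw [Real.norm_eq_abs] at hb
    have := (abs_le.mp hb).2
    simpa using this
  -- hence the exponent is negative and the right-hand side is < a²
  have hexp : Real.exp (-(1 : ℝ) * ((1 : ℕ) : ℝ) ^ 2 * 1 +
      2 * 30 * Real.log 2 * ∫ s in (0 : ℝ)..1, haitaniM 30 a s / logW 1) < 1 := by
    rw [Real.exp_lt_one_iff]
    have : 2 * 30 * Real.log 2 * ∫ s in (0 : ℝ)..1, haitaniM 30 a s / logW 1 ≤ 2 * 30 * Real.log 2 * (31 * a / Real.log 2) :=
      mul_le_mul_of_nonneg_left hint (by positivity)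
    have h' : 2 * 30 * Real.log 2 * (31 * a / Real.log 2) = 1860 * a := by
      field_simp
      ring
    rw [h'] at this
    norm_num [ha_def] at this ⊢
    linarith
  have hR : haitaniM 30 a 0 ^ 2 * Real.exp (-(1 : ℝ) * ((1 : ℕ) : ℝ) ^ 2 * 1 +
      2 * 30 * Real.log 2 * ∫ s in (0 : ℝ)..1, haitaniM 30 a s / logW 1) < a ^ 2 := by
    rw [haitaniM_zero_sq 30 ha.le]
    have ha2 : 0 < a ^ 2 := by positivity
    calc a ^ 2 * Real.exp _ < a ^ 2 * 1 := mul_lt_mul_of_pos_left hexp ha2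
      _ = a ^ 2 := mul_one _
  -- while E₁(1) = G(1)² ≥ (2a)²: e^{−1} − e^{−4} ≥ 1/5
  obtain ⟨q, hq_def⟩ : ∃ q : ℝ, q = Real.exp (-(1 : ℝ)) := ⟨_, rfl⟩
  obtain ⟨r, hr_def⟩ : ∃ r : ℝ, r = Real.exp (-4 * (1 : ℝ)) := ⟨_, rfl⟩
  have hq1 : (9 : ℝ) / 25 < q := by
    rw [hq_def, Real.exp_neg, show (9 : ℝ) / 25 = (25 / 9)⁻¹ by norm_num]
    exact inv_strictAnti₀ (Real.exp_pos 1) (lt_trans Real.exp_one_lt_d9 (by norm_num))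
  have hq2 : q < (2 : ℝ) / 5 := by
    rw [hq_def, Real.exp_neg, show (2 : ℝ) / 5 = (5 / 2)⁻¹ by norm_num]
    exact inv_strictAnti₀ (by norm_num) (lt_trans (by norm_num) Real.exp_one_gt_d9)
  have hq0 : 0 < q := by
    rw [hq_def]
    exact Real.exp_pos _
  have hr4 : r ≤ q * q := by
    rw [hr_def, hq_def, ← Real.exp_add]
    exact Real.exp_le_exp.mpr (by norm_num)
  have hqq : q * q < (4 : ℝ) / 25 := by nlinarith
  have hdiff : (1 : ℝ) / 5 < q - r := by linarith
  have hG : 2 * a < haitaniG 30 a 1 := by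
    have hg : haitaniG 30 a 1 = 30 * a * (q - r) / 3 := by
      rw [hq_def, hr_def]
      rfl
    rw [hg]
    have := mul_lt_mul_of_pos_left hdiff ha
    linarith
  have hL : a ^ 2 < haitaniE 30 a 1 1 := by
    rw [haitaniE_one]
    have h2a : 0 ≤ 2 * a := by positivity
    have := pow_lt_pow_left₀ hG h2a two_ne_zero
    nlinarith
  exact absurd (hmain.trans_lt hR) (not_lt.mpr hL.le)

end Summit.NavierStokesRegularity.NavierStokesRegularity.Theorems.Haitani2025

end

-- WHAT THIS IS NOT: not a claim about NS regularity or blow-up; not a claim about any author beyond the typed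
-- locator.
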